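import Literature.AlgebraicGeometry.Pohlmann1968.HodgeClassesCMTypeProducts
import Literature.FieldTheory.AlgClosed.AutomorphismExtension
import HarnessLib

/-!
# Pohlmann's theorem for a general CM ALGEBRA `E = K₀ × ⋯ × K_{n-1}`: the Hodge classes of a product
# `⨁_{i<n} A_{(K_i; Φ_i)}` of CM abelian varieties with DIFFERENT CM fields — proved on the real carriers

Third member of the family `Pohlmann1968/HodgeClassesCMType` (ONE CM type `(K; Φ)`: Pohlmann 1968, Thm. 1,
`Pohlmann1968_thm1_holds`) and `Pohlmann1968/HodgeClassesCMTypeProducts` (the CM algebra `E = K^n`, one CM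
field: `Pohlmann1968_thm1_product_holds`).  Those two files left the printed generality — an ARBITRARY CM
algebra, i.e. a finite product of possibly different CM fields — unformalised ("WEAKER than the printed
theorem (one CM field)", docstring of `Pohlmann1968_thm1_product`).  This file proves it, as a THEOREM (no
named fact), for every finite family `(A_i, ι_i, θ_i)_{i<n}` of realisations of CM types `Φ_i` of CM fields
`K_i` read on `H¹` (`ComplexMultiplication.IsCMTypeRealisation (Φ i) (A i) (ι i) (θ i)`, the fields `K_i`
varying with `i`) and their product `B = ⨁_i A_i`, on whose `H¹(B, ℚ)` the CM algebra `E = ∏_i K_i` acts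
through `⊕_i ι_i`, freely of rank one.  This is the generality in which the theorem is PRINTED WITH PROOF:

* Z. Gao, E. Ullmo, J. Inst. Math. Jussieu 25 (2025) 215–249 [GaoUllmo2025], §2.1 (held
  `paper:galaxy-pdf-4667137180`, chunk p0007 L1–L7), VERBATIM: "A CM algebra is a finite product of CM fields.
  … A CM pair is a pair `(E, Φ)` consisting of a CM algebra `E` and a CM type `Φ`", and §3.1 **Theorem 3.1
  "(Pohlmann)"** (chunk p0012 L3–L16): "Let `A` be a CM abelian variety, associated with the CM pair `(E, Φ)`.
  … For each `p ≥ 0`, the vector space `B^p(A) ⊗ ℂ` has a basis consisting of `[P]` for those ordered sets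
  `P ∈ 𝒫(S)` with `|P| = 2p` such that (3.2) `|σP ∩ Φ| = |σP ∩ Φ̄|` for all `σ ∈ G`. In particular
  `dim_ℚ B^p(A)` is the number of ordered `P ∈ 𝒫(S)` with `|P| = 2p` satisfying (3.2). **Proof.** Pohlmann
  [Poh68, Thm. 1] states this result when `A` is simple. The proof remains valid for an arbitrary CM abelian
  variety `A`.";
* J. S. Milne, *Hodge classes on abelian varieties* (2020) [Milne2020HodgeClassesAV], 1.1–1.2 (held
  `paper:arxiv-2010.08857`, chunk p0003), VERBATIM: "A complex abelian variety is said to be of CM-type if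
  `End⁰(A)` contains a CM-algebra `E` such that `H¹(A,ℚ)` is free of rank `1` as an `E`-module. Let
  `S = Hom(E,ℂ)` …" and 1.2 (c) "([pohlmann1968], Theorem 1.) … `B^p ⊗ F = ⊕_Δ H^{2p}(A)_Δ`, where `Δ` runs
  over the subsets of `S` with `|(t∘Δ) ∩ Φ| = p = |(t∘Δ) ∩ Φ̄|` for all `t ∈ Gal(F/ℚ)`";
* H. Pohlmann, Ann. of Math. (2) 88 (1968) 161–180 [Pohlmann1968], Thm. 1 (the case `n = 1`, `A` simple;
  primary text not held — acquisition request acq-07563 — quoted through the two sources above and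
  B. B. Gordon's survey [Gordon1999HodgeAVSurvey], §9.2 "Theorem ([B.88] Thm.1)" with proof, held
  `paper:arxiv-alg-geom_9709030`, chunk p0024 L84–L110).

Here `Hom(E, ℂ) = ⊔_i Hom(K_i, ℂ)` is the sigma type `(i : Fin n) × (K i →+* ℂ)`, `Φ = ⊔_i {i} × Φ_i`, and
`σ ∈ G` is read as `τ ∈ Aut(ℂ)` acting on every block by composition (the printed `G = Gal(E^c/ℚ)` acts on
`Hom(E, ℂ)` through `Aut(ℂ)`; for one Galois CM field this is the tree's `isGaloisBalanced_iff_gal`).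

## Contents

* `weightClassesAlg A ι k S` — `H^k(B)_S ⊆ H^k(B(ℂ); ℂ)`: the classes on which every `a = (a_i)_i ∈ ∏_i 𝓞_{K_i}`
  acts (through `(⊕_i ι_i(a_i))^*`) by the character `∏_{(i,s) ∈ S} s(a_i)` (Milne 1.2 (a) "`H^r(A)_Δ` … the
  subspace on which `a ∈ E` acts as `∏_{s∈Δ} s(a)`");
* `IsGaloisBalancedAlg Φ S`, `pohlmannSetsAlg Φ p` — condition (3.2) and the index set of Theorem 3.1;
* `exists_biproductBasis_sigma` — Künneth in degree one for a finite biproduct with factorwise index types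
  (`H¹(⨁ A_j) = ⊕_j π_j^* H¹(A_j)`, the sigma-indexed form of `exists_biproductBasis`);
* **`Pohlmann1968_thm1_cmAlgebra`** — THE THEOREM: `B^p(B) ⊗ ℂ = hodgeClassSpan (⨁ A).dim (⨁ A).X p` equals
  `⨆_{S ∈ pohlmannSetsAlg Φ p} weightClassesAlg A ι (2p) S`, and its dimension is the number of such `S`;
  consumers' forms `weightClassesAlg_le_hodgeClassSpan`, `mem_iSup_weightClassesAlg`.

## Proof (the printed one, run on the carriers with the engine of `Pohlmann1968/HodgeClassesCMType`)

Word for word the argument of `Pohlmann1968_thm1_product_holds` on the index set `⊔_i Hom(K_i, ℂ)`: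
eigenbases of the `H¹(A_i)` (`exists_eigenbasis`) assemble into an eigenbasis `w_{(i,σ)} = π_i^* v_{i,σ}` of
`H¹(B)` for `∏_i 𝓞_{K_i}` (`exists_biproductBasis_sigma`, `map_biproductMap_map_π`); the cup monomials `w_S`
form a basis of `H^{2p}(B)` (`exists_monomialBasis`) and `w_S` spans `H^{2p}(B)_S` (a separating family
`a ∈ ∏_i 𝓞_{K_i}`); `⊆` by the Galois stability of the support of a rational class
(`mem_span_monomials_of_isRationalClass`), `⊇` by Galois descent (`monomial_mem_span_of_stable`), and the
count.  ONE SIMPLIFICATION relative to the `K^n` file: the engine is fed the Galois data `F = ℂ`,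
`G = Aut(ℂ)` directly (eigenvalues `σ(a_i) ∈ ℂ`, permutations `(i, σ) ↦ (i, τ ∘ σ)`), the descent input
"an `Aut(ℂ)`-invariant complex number is rational" being the tree's
`Complex.isIntegral_of_forall_ringEquiv_mem` / `Complex.natDegree_minpoly_le_card`
(`FieldTheory/AlgClosed/AutomorphismExtension`; cf. `exists_ratCast_eq_of_forall_ringEquiv` in
`NumberTheory/EllipticCurves/LatticeInclusionRigidityProofs`, re-derived here in four lines to keep the
import cone inside `FieldTheory`) — so no common Galois closure of the `K_i` is needed.

No named fact, no `sorry`; axioms `propext`, `Classical.choice`, `Quot.sound`.  Not here: the passage from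
an abstract CM abelian variety (`Milne1999.IsOfCMType`) to such a product up to isogeny (Shimura's
structure theory; the tree's `ComplexMultiplication/ShimuraIsogeny*`), and orders smaller than `∏ 𝓞_{K_i}`.

## References

* [GaoUllmo2025] Z. Gao, E. Ullmo, *Hodge cycles and quadratic relations between holomorphic periods on CM
  abelian varieties*, J. Inst. Math. Jussieu 25 (2025) 215–249, §2.1 and Thm. 3.1 with proof.
* [Milne2020HodgeClassesAV] J. S. Milne, *Hodge classes on abelian varieties* (2020), 1.1–1.2.
* [Pohlmann1968] H. Pohlmann, *Algebraic cycles on abelian varieties of complex multiplication type*,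
  Ann. of Math. (2) 88 (1968) 161–180, Thm. 1.
* [Gordon1999HodgeAVSurvey] B. B. Gordon, *A survey of the Hodge conjecture for abelian varieties*, §9.2.
* [HatcherAT2002] A. Hatcher, *Algebraic Topology*, §3.2, Thm. 3.16 (Künneth).
* [Cox2013] D. A. Cox, *Galois Theory*, 2nd ed., §10.C, proof of Thm. 10.23 (conjugates under `Aut(ℂ)`).
-/

noncomputable section

open CategoryTheory CategoryTheory.Limits NumberField

namespace Literature.AlgebraicGeometry.Pohlmann1968

open Literature.AlgebraicGeometry.Motives (AbelianVariety CMType)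
open Literature.AlgebraicGeometry.HodgeTheory (complexBetti)
open Literature.AlgebraicGeometry.ComplexMultiplication (IsCMTypeRealisation)
open Literature.AlgebraicGeometry.VanGeemen1994 (hodgeClassSpan)

/-! ### Definitions: weights indexed by `Hom(∏ K_i, ℂ) = ⊔_i Hom(K_i, ℂ)` -/

section DefsAlg

variable {n : ℕ} {K : Fin n → Type} [∀ i, Field (K i)]
variable (A : Fin n → AbelianVariety ℂ) (ι : ∀ i, 𝓞 (K i) →+* End (A i))

/-- **`H^k(B)_S ⊆ H^k(B(ℂ); ℂ)`, the weight classes of weight `S`** on the product `B = ⨁_{i<n} A_i` of abelian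
varieties with `𝓞_{K_i}`-actions `ι_i`, for a finite `S ⊆ Hom(∏_i K_i, ℂ) = ⊔_i Hom(K_i, ℂ)`: the classes `c`
with `(⊕_i ι_i(a_i))^* c = (∏_{(i,s) ∈ S} s(a_i)) · c` for every `a = (a_i)_i ∈ ∏_i 𝓞_{K_i}` — Milne 1.2 (a) for
the CM algebra `E = ∏_i K_i`: "`H^r(A)_Δ = ⊗_{s∈Δ} H¹(A)_s` is the (one-dimensional) subspace on which `a ∈ E`
acts as `∏_{s∈Δ} s(a)`"; Gao–Ullmo's `ℂ·[P]`.  A `ℂ`-submodule for all data.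
[cite: Milne2020HodgeClassesAV, 1.1–1.2 (a)] [cite: GaoUllmo2025, §2.1 and Thm. 3.1] -/
def weightClassesAlg (k : ℕ) (S : Finset ((i : Fin n) × (K i →+* ℂ))) :
    Submodule ℂ (complexBetti (⨁ A).X k) where
  carrier := {c | ∀ a : ∀ i, 𝓞 (K i),
    complexBetti.map (biproduct.map fun i => ι i (a i)).hom.hom.hom k c =
      (∏ x ∈ S, x.2 ((a x.1 : 𝓞 (K x.1)) : K x.1)) • c}
  add_mem' {c c'} hc hc' a := by rw [map_add, hc a, hc' a, smul_add]
  zero_mem' a := by rw [map_zero, smul_zero]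
  smul_mem' z {c} hc a := by rw [map_smul, hc a, smul_comm]

variable {A ι} in
/-- Membership in `weightClassesAlg` is the defining eigen-condition (definitional unfolding).
[cite: Milne2020HodgeClassesAV, 1.2 (a)] -/
theorem mem_weightClassesAlg_iff {k : ℕ} {S : Finset ((i : Fin n) × (K i →+* ℂ))}
    {c : complexBetti (⨁ A).X k} :
    c ∈ weightClassesAlg A ι k S ↔ ∀ a : ∀ i, 𝓞 (K i),
      complexBetti.map (biproduct.map fun i => ι i (a i)).hom.hom.hom k c =
        (∏ x ∈ S, x.2 ((a x.1 : 𝓞 (K x.1)) : K x.1)) • c :=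
  Iff.rfl

/-- **Gao–Ullmo's condition (3.2) for the CM pair `(∏_i K_i, ⊔_i {i} × Φ_i)`** (= Milne 1.2 (c); Pohlmann's
condition (9.2.1) for `n = 1`): "`|σP ∩ Φ| = |σP ∩ Φ̄|` for all `σ ∈ G`", i.e. for every `τ ∈ Aut(ℂ)`,
`#{(i,s) ∈ S | τ ∘ s ∈ Φ_i} = #{(i,s) ∈ S | τ ∘ s ∉ Φ_i}` (`G = Gal(E^c/ℚ)` acts on `Hom(E, ℂ)` through
`Aut(ℂ)`, every automorphism of `E^c` extending to `ℂ`). [cite: GaoUllmo2025, Thm. 3.1 (3.2)]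
[cite: Milne2020HodgeClassesAV, 1.2 (c)] -/
def IsGaloisBalancedAlg (Φ : ∀ i, CMType (K i)) (S : Finset ((i : Fin n) × (K i →+* ℂ))) : Prop :=
  ∀ τ : ℂ ≃+* ℂ,
    {x | x ∈ S ∧ (τ : ℂ →+* ℂ).comp x.2 ∈ (Φ x.1).1}.ncard =
      {x | x ∈ S ∧ (τ : ℂ →+* ℂ).comp x.2 ∉ (Φ x.1).1}.ncard

/-- **The index set of Theorem 3.1 for `(∏_i K_i, ⊔_i Φ_i)`**: the `S ⊆ ⊔_i Hom(K_i, ℂ)` with `|S| = 2p`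
satisfying (3.2). [cite: GaoUllmo2025, Thm. 3.1] -/
def pohlmannSetsAlg (Φ : ∀ i, CMType (K i)) (p : ℕ) : Set (Finset ((i : Fin n) × (K i →+* ℂ))) :=
  {S | S.card = 2 * p ∧ IsGaloisBalancedAlg Φ S}

/-- Unfolding of `IsGaloisBalancedAlg`. [cite: GaoUllmo2025, Thm. 3.1 (3.2)] -/
theorem isGaloisBalancedAlg_iff {Φ : ∀ i, CMType (K i)} {S : Finset ((i : Fin n) × (K i →+* ℂ))} :
    IsGaloisBalancedAlg Φ S ↔ ∀ τ : ℂ ≃+* ℂ,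
      {x | x ∈ S ∧ (τ : ℂ →+* ℂ).comp x.2 ∈ (Φ x.1).1}.ncard =
        {x | x ∈ S ∧ (τ : ℂ →+* ℂ).comp x.2 ∉ (Φ x.1).1}.ncard :=
  Iff.rfl

/-- Unfolding of `pohlmannSetsAlg`. [cite: GaoUllmo2025, Thm. 3.1] -/
theorem mem_pohlmannSetsAlg_iff {Φ : ∀ i, CMType (K i)} {p : ℕ} {S : Finset ((i : Fin n) × (K i →+* ℂ))} :
    S ∈ pohlmannSetsAlg Φ p ↔ S.card = 2 * p ∧ IsGaloisBalancedAlg Φ S :=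
  Iff.rfl

/-- A balanced weight has `|S| = 2 · #{(i,s) ∈ S | s ∈ Φ_i}` (take `τ = 1`; for `|S| = 2p` this is
`|S ∩ Φ| = p = |S ∩ Φ̄|`). [cite: Milne2020HodgeClassesAV, 1.2 (c)] -/
theorem IsGaloisBalancedAlg.card_eq_two_mul {Φ : ∀ i, CMType (K i)}
    {S : Finset ((i : Fin n) × (K i →+* ℂ))} (h : IsGaloisBalancedAlg Φ S) :
    S.card = 2 * {x | x ∈ S ∧ x.2 ∈ (Φ x.1).1}.ncard := by
  have h1 := h (RingEquiv.refl ℂ)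
  have hcomp : ∀ x : (i : Fin n) × (K i →+* ℂ), ((RingEquiv.refl ℂ : ℂ ≃+* ℂ) : ℂ →+* ℂ).comp x.2 = x.2 :=
    fun x => RingHom.ext fun _ => rfl
  simp only [hcomp] at h1
  have hdisj : Disjoint {x | x ∈ S ∧ x.2 ∈ (Φ x.1).1} {x | x ∈ S ∧ x.2 ∉ (Φ x.1).1} :=
    Set.disjoint_left.mpr fun x hx hx' => hx'.2 hx.2
  have hunion : {x | x ∈ S ∧ x.2 ∈ (Φ x.1).1} ∪ {x | x ∈ S ∧ x.2 ∉ (Φ x.1).1} =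
      (S : Set ((i : Fin n) × (K i →+* ℂ))) := by
    ext x
    simp only [Set.mem_union, Set.mem_setOf_eq, Finset.mem_coe]
    tauto
  have hfin₁ : {x | x ∈ S ∧ x.2 ∈ (Φ x.1).1}.Finite := S.finite_toSet.subset fun x hx => hx.1
  have hfin₂ : {x | x ∈ S ∧ x.2 ∉ (Φ x.1).1}.Finite := S.finite_toSet.subset fun x hx => hx.1
  have hsum := Set.ncard_union_eq hdisj hfin₁ hfin₂
  rw [hunion, Set.ncard_coe_finset] at hsum
  omega

/-- The empty weight is balanced (`p = 0`: `B⁰ ⊗ ℂ = H⁰`). [cite: GaoUllmo2025, Thm. 3.1] -/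
theorem isGaloisBalancedAlg_empty (Φ : ∀ i, CMType (K i)) : IsGaloisBalancedAlg Φ ∅ := fun _ => by
  simp only [Finset.notMem_empty, false_and, Set.setOf_false, Set.ncard_empty]

/-- `∅ ∈ pohlmannSetsAlg Φ 0`. [cite: GaoUllmo2025, Thm. 3.1] -/
theorem empty_mem_pohlmannSetsAlg_zero (Φ : ∀ i, CMType (K i)) :
    (∅ : Finset ((i : Fin n) × (K i →+* ℂ))) ∈ pohlmannSetsAlg Φ 0 :=
  ⟨by simp, isGaloisBalancedAlg_empty Φ⟩

end DefsAlg

open Module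
open Literature.AlgebraicTopology.SingularHomology
open Literature.AlgebraicGeometry.Motives (IsSmoothProjective ComplexPoints)
open Literature.AlgebraicGeometry.HodgeTheory

/-! ### Step 0: linear algebra and the descent input over `Aut(ℂ)` (private) -/

section LinearAlgebraA

/-- If an operator acts on a basis by pairwise distinct scalars, an eigenvector for one of these scalars is a
multiple of the corresponding basis vector (private copy of the one-type file's helper). [folklore] -/
private theorem mem_span_singleton_of_apply_eq_smul'' {ι M : Type*} [Fintype ι] [AddCommGroup M]
    [Module ℂ M] (b : Basis ι ℂ M) (φ : M →ₗ[ℂ] M) (lam : ι → ℂ)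
    (hφ : ∀ i, φ (b i) = lam i • b i) (hlam : Function.Injective lam) {x : M} {i₀ : ι}
    (hx : φ x = lam i₀ • x) : x ∈ ℂ ∙ b i₀ := by
  have hx' : ∑ i, (b.repr x i * lam i - lam i₀ * b.repr x i) • b i = 0 := by
    simp only [sub_smul, Finset.sum_sub_distrib, mul_smul]
    rw [sub_eq_zero]
    have h1 : φ x = ∑ i, b.repr x i • lam i • b i := by
      conv_lhs => rw [← b.sum_repr x]
      simp only [map_sum, map_smul, hφ]
    have h2 : lam i₀ • x = ∑ i, lam i₀ • b.repr x i • b i := by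
      conv_lhs => rw [← b.sum_repr x]
      rw [Finset.smul_sum]
    rw [← h1, ← h2, hx]
  have hcoef := Fintype.linearIndependent_iff.1 b.linearIndependent _ hx'
  have hzero : ∀ i, i ≠ i₀ → b.repr x i = 0 := by
    intro i hi
    have h := hcoef i
    rw [mul_comm (lam i₀), ← mul_sub, mul_eq_zero] at h
    rcases h with h | h
    · exact h
    · exact absurd (hlam (sub_eq_zero.1 h)) hi
  rw [Submodule.mem_span_singleton]
  refine ⟨b.repr x i₀, ?_⟩
  conv_rhs => rw [← b.sum_repr x]
  rw [Finset.sum_eq_single i₀ (fun i _ hi => by rw [hzero i hi, zero_smul])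
    (fun h => absurd (Finset.mem_univ i₀) h)]

/-- `dim span (b '' B) = |B|` for a basis `b` (private copy of the one-type file's helper). [folklore] -/
private theorem finrank_span_image_basis'' {ι M : Type*} [AddCommGroup M] [Module ℂ M] (b : Basis ι ℂ M)
    (B : Finset ι) : Module.finrank ℂ (Submodule.span ℂ (b '' ↑B)) = B.card := by
  have hli : LinearIndependent ℂ (fun t : ↥B => b t) :=
    b.linearIndependent.comp _ Subtype.val_injective
  rw [show b '' ↑B = Set.range (fun t : ↥B => b t) by ext; simp, finrank_span_eq_card hli,
    Fintype.card_coe]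

/-- Counting through an embedding (private copy of the one-type file's helper). [folklore] -/
private theorem ncard_sep_map_eq'' {α β : Type*} (f : α ↪ β) (s : Finset α) (Q : β → Prop) :
    {i | i ∈ s.map f ∧ Q i}.ncard = {j | j ∈ s ∧ Q (f j)}.ncard := by
  rw [show {i | i ∈ s.map f ∧ Q i} = f '' {j | j ∈ s ∧ Q (f j)} by
      ext i
      simp only [Finset.mem_map, Set.mem_setOf_eq, Set.mem_image]
      constructor
      · rintro ⟨⟨j, hj, rfl⟩, hQ⟩; exact ⟨j, ⟨hj, hQ⟩, rfl⟩
      · rintro ⟨j, ⟨hj, hQ⟩, rfl⟩; exact ⟨⟨j, hj, rfl⟩, hQ⟩,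
    Set.ncard_image_of_injective _ f.injective]

open Polynomial in
/-- **A complex number fixed by every automorphism of `ℂ` is rational** (the fixed field of `Aut(ℂ)`
is `ℚ`): its `Aut(ℂ)`-orbit is `{x}`, so `x` is algebraic with all conjugates equal to `x`, i.e.
`deg minpoly_ℚ(x) = 1` (the tree's `Complex.isIntegral_of_forall_ringEquiv_mem`,
`Complex.natDegree_minpoly_le_card`; the same four lines as
`Literature.NumberTheory.EllipticCurves.exists_ratCast_eq_of_forall_ringEquiv`, repeated to keep the imports
inside `FieldTheory`). [cite: Cox2013, §10.C proof of Thm. 10.23] -/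
private theorem mem_range_algebraMap_rat_of_forall_ringEquiv {x : ℂ}
    (h : ∀ τ : ℂ ≃+* ℂ, (τ : ℂ →+* ℂ) x = x) : x ∈ Set.range (algebraMap ℚ ℂ) := by
  classical
  have hmem : ∀ σ : ℂ ≃+* ℂ, σ x ∈ ({x} : Finset ℂ) := fun σ => by
    rw [Finset.mem_singleton]; exact h σ
  have hint : IsIntegral ℚ x :=
    Literature.FieldTheory.AlgClosed.Complex.isIntegral_of_forall_ringEquiv_mem
      (Finset.finite_toSet {x}) (by simpa using hmem)
  have hle : (minpoly ℚ x).natDegree ≤ 1 := by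
    simpa using Literature.FieldTheory.AlgClosed.Complex.natDegree_minpoly_le_card hmem
  have hge : 0 < (minpoly ℚ x).natDegree := minpoly.natDegree_pos hint
  have hdeg : (minpoly ℚ x).degree = 1 := by
    rw [degree_eq_natDegree (minpoly.ne_zero hint)]
    exact_mod_cast le_antisymm hle hge
  obtain ⟨q, hq⟩ := minpoly.mem_range_of_degree_eq_one ℚ x hdeg
  exact ⟨q, hq⟩

end LinearAlgebraA

/-! ### Step 1: `H¹(⨁ Aⱼ) = ⊕ⱼ πⱼ^* H¹(Aⱼ)` with factorwise index types (sigma-indexed Künneth basis) -/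

section BiproductH1A

variable {J : Type} [Fintype J] (A : J → AbelianVariety ℂ)

/-- **An `H¹`-basis of a finite biproduct from `H¹`-bases of the factors, factorwise index types**: if
`v j` is a basis of `H¹(Aⱼ(ℂ); ℂ)` indexed by `S j`, the classes `πⱼ^* (v j s)` form a basis of
`H¹((⨁ Aⱼ)(ℂ); ℂ)` indexed by `Σ j, S j` (Künneth in degree one; the sigma-indexed form of
`exists_biproductBasis`, same proof: `ιᵢ^* πⱼ^* = δᵢⱼ` and `x = Σⱼ πⱼ^* ιⱼ^* x` on `H¹`).
[cite: HatcherAT2002, §3.2 Thm. 3.16] [cite: LangeBirkenhake1992, §1.1] -/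
theorem exists_biproductBasis_sigma {S : J → Type} [∀ j, Fintype (S j)]
    (v : ∀ j, Basis (S j) ℂ (complexBetti (A j).X 1)) :
    ∃ w : Basis ((j : J) × S j) ℂ (complexBetti (⨁ A).X 1),
      ∀ x, w x = complexBetti.map (biproduct.π A x.1).hom.hom.hom 1 (v x.1 x.2) := by
  classical
  let f : ((j : J) × S j) → complexBetti (⨁ A).X 1 := fun x =>
    complexBetti.map (biproduct.π A x.1).hom.hom.hom 1 (v x.1 x.2)
  have hli : LinearIndependent ℂ f := by
    rw [Fintype.linearIndependent_iff]
    rintro c hc ⟨i, s⟩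
    have h : complexBetti.map (biproduct.ι A i).hom.hom.hom 1 (∑ x, c x • f x) =
        complexBetti.map (biproduct.ι A i).hom.hom.hom 1 0 := by rw [hc]
    rw [map_sum, map_zero, Fintype.sum_sigma,
      Finset.sum_eq_single i (fun j _ hji => by
        refine Finset.sum_eq_zero fun s _ => ?_
        rw [map_smul]
        change c ⟨j, s⟩ • complexBetti.map (biproduct.ι A i).hom.hom.hom 1
          (complexBetti.map (biproduct.π A j).hom.hom.hom 1 (v j s)) = 0
        rw [map_ι_map_π_ne A (Ne.symm hji), smul_zero])
      (fun h => absurd (Finset.mem_univ i) h)] at h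
    have h' : ∑ s, c ⟨i, s⟩ • v i s = 0 := by
      rw [← h]
      refine Finset.sum_congr rfl fun s _ => ?_
      rw [map_smul]
      change _ = c ⟨i, s⟩ • complexBetti.map (biproduct.ι A i).hom.hom.hom 1
        (complexBetti.map (biproduct.π A i).hom.hom.hom 1 (v i s))
      rw [map_ι_map_π_self]
    exact Fintype.linearIndependent_iff.1 (v i).linearIndependent (fun s => c ⟨i, s⟩) h' s
  have hsp : ⊤ ≤ Submodule.span ℂ (Set.range f) := by
    intro x _
    rw [← sum_map_π_map_ι A x]
    refine Submodule.sum_mem _ fun j _ => ?_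
    rw [← (v j).sum_repr (complexBetti.map (biproduct.ι A j).hom.hom.hom 1 x), map_sum]
    refine Submodule.sum_mem _ fun s _ => ?_
    rw [map_smul]
    exact Submodule.smul_mem _ _ (Submodule.subset_span ⟨⟨j, s⟩, rfl⟩)
  exact ⟨Basis.mk hli hsp, fun x => by rw [Basis.mk_apply]⟩

end BiproductH1A

/-! ### Step 2: a separating family `a ∈ ∏_i 𝓞_{K_i}` (private) -/

section SeparatingA

open Polynomial in
/-- **A separating family of integral elements for different fields**: some `a = (a_i)_i ∈ ∏_i 𝓞_{K_i}` has
pairwise distinct weight characters `∏_{(i,σ) ∈ S} σ(a_i)` over ALL finite `S ⊆ ⊔_i Hom(K_i, ℂ)` (take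
`a_i = a_i⁰ + iM + N` with `a_i⁰` an integral primitive element of `K_i`, `M ∈ ℕ` making
`(i, σ) ↦ σ(a_i⁰) + iM` injective, and `N ∈ ℕ` avoiding the finitely many roots of the differences of the
polynomials `∏_{x ∈ S} (X + σ a_i⁰ + iM)`, `S ≠ T`; the proof of `exists_separating_family` of the `K^n`
file with one primitive element per field). [folklore] -/
private theorem exists_separating_family_alg {n : ℕ} (K : Fin n → Type) [∀ i, Field (K i)]
    [∀ i, NumberField (K i)] :
    ∃ a : ∀ i, 𝓞 (K i), Function.Injective
      fun S : Finset ((i : Fin n) × (K i →+* ℂ)) => ∏ x ∈ S, x.2 ((a x.1 : 𝓞 (K x.1)) : K x.1) := by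
  classical
  -- for each field an integral element separating its embeddings
  have hex : ∀ i, ∃ a : 𝓞 (K i), Function.Injective fun σ : K i →+* ℂ => σ (a : K i) := by
    intro i
    obtain ⟨α, hα⟩ := Field.exists_primitive_element ℚ (K i)
    have hinjα : Function.Injective fun φ : K i →ₐ[ℚ] ℂ => φ α :=
      (Field.primitive_element_iff_algHom_eq_of_eval' ℚ ℂ (fun x => IsAlgClosed.splits _) α).1 hα
    have hαℤ : IsAlgebraic ℤ α :=
      (IsFractionRing.isAlgebraic_iff ℤ ℚ (K i)).2 (Algebra.IsAlgebraic.isAlgebraic α)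
    obtain ⟨m, a, hm, hma⟩ := hαℤ.exists_nsmul_eq (𝓞 (K i))
    refine ⟨a, fun σ σ' h => ?_⟩
    have h' : σ α = σ' α := by
      have hσ : σ (a : K i) = (m : ℂ) * σ α := by
        rw [show ((a : 𝓞 (K i)) : K i) = m • α from hma.symm, nsmul_eq_mul, map_mul, map_natCast]
      have hσ' : σ' (a : K i) = (m : ℂ) * σ' α := by
        rw [show ((a : 𝓞 (K i)) : K i) = m • α from hma.symm, nsmul_eq_mul, map_mul, map_natCast]
      have hh : (m : ℂ) * σ α = (m : ℂ) * σ' α := by rw [← hσ, ← hσ']; exact h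
      exact mul_left_cancel₀ (Nat.cast_ne_zero.2 hm) hh
    have h'' := hinjα (show (fun φ : K i →ₐ[ℚ] ℂ => φ α) σ.toRatAlgHom =
      (fun φ : K i →ₐ[ℚ] ℂ => φ α) σ'.toRatAlgHom from h')
    rw [← RingHom.toRatAlgHom_toRingHom σ, ← RingHom.toRatAlgHom_toRingHom σ', h'']
  choose a hinja using hex
  -- slot shifts `i·M` making `(i, σ) ↦ σ(a_i) + i·M` injective
  set bad₁ : Finset ℂ :=
    (Finset.univ : Finset (((i : Fin n) × (K i →+* ℂ)) × ((i : Fin n) × (K i →+* ℂ)))).image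
      fun xy => (xy.1.2 ((a xy.1.1 : 𝓞 (K xy.1.1)) : K xy.1.1) -
          xy.2.2 ((a xy.2.1 : 𝓞 (K xy.2.1)) : K xy.2.1)) /
        (((xy.2.1 : ℕ) : ℂ) - ((xy.1.1 : ℕ) : ℂ))
    with hbad₁_def
  obtain ⟨M, hM⟩ : ∃ M : ℕ, (M : ℂ) ∉ bad₁ := by
    by_contra h
    simp only [not_exists, not_not] at h
    exact Set.Infinite.mono (Set.range_subset_iff.2 fun N => (Finset.mem_coe.2 (h N)))
      (Set.infinite_range_of_injective (Nat.cast_injective (R := ℂ))) bad₁.finite_toSet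
  set w : ((i : Fin n) × (K i →+* ℂ)) → ℂ := fun x =>
    -(x.2 ((a x.1 : 𝓞 (K x.1)) : K x.1) + ((x.1 : ℕ) : ℂ) * M) with hw_def
  have hw : Function.Injective w := by
    rintro ⟨i, σ⟩ ⟨j, σ'⟩ h
    have h' : σ ((a i : 𝓞 (K i)) : K i) + ((i : ℕ) : ℂ) * M =
        σ' ((a j : 𝓞 (K j)) : K j) + ((j : ℕ) : ℂ) * M := by
      have h1 := h
      simp only [hw_def, neg_inj] at h1
      exact h1
    by_cases hij : i = j
    · subst hij
      exact Sigma.ext rfl (heq_of_eq (hinja i (add_right_cancel h')))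
    · exfalso
      apply hM
      rw [hbad₁_def, Finset.mem_image]
      refine ⟨(⟨i, σ⟩, ⟨j, σ'⟩), Finset.mem_univ _, ?_⟩
      have hji : ((j : ℕ) : ℂ) - ((i : ℕ) : ℂ) ≠ 0 := by
        refine sub_ne_zero.2 fun h => hij (Fin.ext ?_)
        exact_mod_cast h.symm
      show (σ ((a i : 𝓞 (K i)) : K i) - σ' ((a j : 𝓞 (K j)) : K j)) /
          (((j : ℕ) : ℂ) - ((i : ℕ) : ℂ)) = M
      rw [div_eq_iff hji]
      linear_combination h'
  -- the polynomials `pp S = ∏_{x ∈ S} (X - w x)` are pairwise distinct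
  set pp : Finset ((i : Fin n) × (K i →+* ℂ)) → ℂ[X] := fun S => ∏ x ∈ S, (X - C (w x)) with hpp_def
  have hroots : ∀ S, (pp S).roots = S.val.map w := fun S => by
    rw [hpp_def]
    simp only
    rw [Finset.prod_eq_multiset_prod,
      show (fun x => X - C (w x)) = (fun z => X - C z) ∘ w from rfl, ← Multiset.map_map,
      Polynomial.roots_multiset_prod_X_sub_C]
  have hpinj : Function.Injective pp := fun S T h =>
    Finset.val_injective (Multiset.map_injective hw (by rw [← hroots, ← hroots, h]))
  -- avoid the finitely many bad common shifts
  set bad : Finset ℂ :=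
    (Finset.univ : Finset (Finset ((i : Fin n) × (K i →+* ℂ)) ×
      Finset ((i : Fin n) × (K i →+* ℂ)))).biUnion
      fun st => (pp st.1 - pp st.2).roots.toFinset with hbad_def
  obtain ⟨N, hN⟩ : ∃ N : ℕ, (N : ℂ) ∉ bad := by
    by_contra h
    simp only [not_exists, not_not] at h
    exact Set.Infinite.mono (Set.range_subset_iff.2 fun N => (Finset.mem_coe.2 (h N)))
      (Set.infinite_range_of_injective (Nat.cast_injective (R := ℂ))) bad.finite_toSet
  refine ⟨fun i => a i + ((i : ℕ) * M + N : ℕ), fun S T hST => ?_⟩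
  -- `∏_{(i,σ) ∈ S} σ(a_i + iM + N) = (pp S)(N)`
  have heval : ∀ S : Finset ((i : Fin n) × (K i →+* ℂ)),
      ∏ x ∈ S, x.2 (((a x.1 + ((x.1 : ℕ) * M + N : ℕ) : 𝓞 (K x.1)) : K x.1)) =
        (pp S).eval (N : ℂ) := by
    intro S
    rw [hpp_def]
    simp only
    rw [Polynomial.eval_prod]
    refine Finset.prod_congr rfl fun x _ => ?_
    rw [Polynomial.eval_sub, Polynomial.eval_X, Polynomial.eval_C, hw_def]
    simp only [RingOfIntegers.coe_eq_algebraMap, map_add, map_mul, map_natCast, Nat.cast_add,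
      Nat.cast_mul, sub_neg_eq_add]
    ring
  have hST' : (pp S).eval (N : ℂ) = (pp T).eval (N : ℂ) := by
    rw [← heval, ← heval]
    exact hST
  by_contra hne
  have hp : pp S - pp T ≠ 0 := sub_ne_zero.2 fun h => hne (hpinj h)
  apply hN
  rw [hbad_def, Finset.mem_biUnion]
  refine ⟨(S, T), Finset.mem_univ _, ?_⟩
  rw [Multiset.mem_toFinset, Polynomial.mem_roots hp, Polynomial.IsRoot, Polynomial.eval_sub,
    sub_eq_zero]
  exact hST'

end SeparatingA

/-! ### The theorem -/

section TheoremA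

open Literature.NumberTheory.Automorphic.PicardCM (eigenline)

/-- **Pohlmann's theorem for a general CM algebra `E = ∏_{i<n} K_i` (Gao–Ullmo 2025, Thm. 3.1
"(Pohlmann)" for the CM pair `(∏_i K_i, ⊔_i {i} × Φ_i)`; Milne 2020, 1.2 (c); Pohlmann 1968, Thm. 1 for
`n = 1`)**, VERBATIM (Gao–Ullmo): "For each `p ≥ 0`, the vector space `B^p(A) ⊗ ℂ` has a basis consisting of
`[P]` for those ordered sets `P ∈ 𝒫(S)` with `|P| = 2p` such that `|σP ∩ Φ| = |σP ∩ Φ̄|` for all `σ ∈ G`. In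
particular `dim_ℚ B^p(A)` is the number of ordered `P ∈ 𝒫(S)` with `|P| = 2p` satisfying (3.2)."  ON THE
CARRIERS: for every finite family of number fields `K_i`, realisations `(A_i, ι_i, θ_i)` of CM types `Φ_i`
of `K_i` read on `H¹`, `B = ⨁_i A_i`, and every `p`: (i) `B^p(B) ⊗ ℂ = hodgeClassSpan (⨁ A).dim (⨁ A).X p`
EQUALS the supremum of the weight spaces `weightClassesAlg A ι (2p) S` over `S ∈ pohlmannSetsAlg Φ p`
(`|S| = 2p`, balanced under `Aut(ℂ)`); (ii) its `ℂ`-dimension is the number of such `S`.  (Only the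
realisation data are used: that the `K_i` are CM fields is not needed formally.)  PROOF = the printed one
(module docstring § Proof): eigenbasis `w_{(i,σ)} = π_i^* v_{i,σ}` of `H¹(B)` (`exists_eigenbasis`,
`exists_biproductBasis_sigma`), monomial basis of `H^{2p}(B)` (`exists_monomialBasis`), `⊆` by
`mem_span_monomials_of_isRationalClass`, `⊇` by `monomial_mem_span_of_stable` with the Galois data
`F = ℂ`, `G = Aut(ℂ)`, count by `finrank`. [cite: GaoUllmo2025, §2.1 and Thm. 3.1 with proof]
[cite: Milne2020HodgeClassesAV, 1.1–1.2 (c)] [cite: Pohlmann1968, Thm. 1]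
[cite: Gordon1999HodgeAVSurvey, §9.2] -/
theorem Pohlmann1968_thm1_cmAlgebra {n : ℕ} (K : Fin n → Type) [∀ i, Field (K i)]
    [∀ i, NumberField (K i)] (A : Fin n → AbelianVariety ℂ) (Φ : ∀ i, CMType (K i))
    (ι : ∀ i, 𝓞 (K i) →+* End (A i)) (θ : ∀ i, K i →+* Module.End ℂ (complexBetti (A i).X 1))
    (hA : ∀ i, IsCMTypeRealisation (Φ i) (A i) (ι i) (θ i)) (p : ℕ) :
    hodgeClassSpan (⨁ A).dim (⨁ A).X p =
        ⨆ S ∈ pohlmannSetsAlg Φ p, weightClassesAlg A ι (2 * p) S ∧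
      Module.finrank ℂ ↥(hodgeClassSpan (⨁ A).dim (⨁ A).X p) = (pohlmannSetsAlg Φ p).ncard := by
  classical
  have hX : IsSmoothProjective (⨁ A).dim (⨁ A).X := Motives.AbelianVariety.isSmoothProjective_holds
  -- (1) a separating family, eigenbases of the factors, the eigenbasis `w` of `H¹(⨁ A)`
  obtain ⟨a, ha⟩ := exists_separating_family_alg K
  have ha1 : ∀ i, Function.Injective fun σ : K i →+* ℂ => σ ((a i : 𝓞 (K i)) : K i) := by
    intro i σ σ' h
    have h' : ({⟨i, σ⟩} : Finset ((i : Fin n) × (K i →+* ℂ))) = {⟨i, σ'⟩} :=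
      ha (by simpa only [Finset.prod_singleton] using h)
    exact eq_of_heq (Sigma.mk.inj_iff.1 (Finset.singleton_injective h')).2
  have hvex : ∀ i, ∃ v : Basis (K i →+* ℂ) ℂ (complexBetti (A i).X 1),
      ∀ σ (c : K i), θ i c (v σ) = σ c • v σ := fun i => exists_eigenbasis (hA i) (ha1 i)
  choose v hv using hvex
  obtain ⟨w, hw⟩ := exists_biproductBasis_sigma A v
  have hvl : ∀ i σ, v i σ ∈ eigenline (θ i) σ := fun i σ =>
    (Submodule.mem_iInf _).2 fun c => Module.End.mem_eigenspace_iff.2 (hv i σ c)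
  have hθ : ∀ (i : Fin n) (c : 𝓞 (K i)) (σ : K i →+* ℂ),
      complexBetti.map (ι i c).hom.hom.hom 1 (v i σ) = σ (c : K i) • v i σ := fun i c σ => by
    rw [show complexBetti.map (ι i c).hom.hom.hom 1 (v i σ) =
      (complexBetti.map (ι i c).hom.hom.hom 1).hom (v i σ) from rfl, (hA i).2.2.1 c]
    exact hv i σ c
  have hwθ : ∀ (c : ∀ i, 𝓞 (K i)) (x : (i : Fin n) × (K i →+* ℂ)),
      complexBetti.map (biproduct.map fun i => ι i (c i)).hom.hom.hom 1 (w x) =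
        x.2 ((c x.1 : 𝓞 (K x.1)) : K x.1) • w x := fun c x => by
    rw [hw x, map_biproductMap_map_π, hθ, map_smul]
  have hv10 : ∀ x, (fun x : (i : Fin n) × (K i →+* ℂ) => x.2 ∈ (Φ x.1).1) x →
      IsOfHodgeType (⨁ A).dim (⨁ A).X 1 1 0 (w x) := fun x hx => by
    rw [hw x]
    exact (((hA x.1).2.2.2 x.2).2.1 hx (v x.1 x.2) (hvl x.1 x.2)).map_of_isSmoothProjective hX
      (hA x.1).1 _
  have hv01 : ∀ x, ¬ (fun x : (i : Fin n) × (K i →+* ℂ) => x.2 ∈ (Φ x.1).1) x →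
      IsOfHodgeType (⨁ A).dim (⨁ A).X 1 0 1 (w x) := fun x hx => by
    rw [hw x]
    exact (((hA x.1).2.2.2 x.2).2.2 hx (v x.1 x.2) (hvl x.1 x.2)).map_of_isSmoothProjective hX
      (hA x.1).1 _
  -- (2) the monomial basis of `H^{2p}(⨁ A)`
  letI : LinearOrder ((i : Fin n) × (K i →+* ℂ)) :=
    LinearOrder.lift' (Fintype.equivFin ((i : Fin n) × (K i →+* ℂ)))
      (Fintype.equivFin ((i : Fin n) × (K i →+* ℂ))).injective
  obtain ⟨b, hb⟩ := exists_monomialBasis w (2 * p)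
  -- (3) the Galois data: `F = ℂ`, eigenvalues `ev (i,σ) = σ(a_i)`, `G = Aut(ℂ)` acting on
  -- `⊔_i Hom(K_i, ℂ)` by composition
  let perm : (ℂ ≃+* ℂ) → (((i : Fin n) × (K i →+* ℂ)) ↪ ((i : Fin n) × (K i →+* ℂ))) := fun τ =>
    ⟨fun x => ⟨x.1, (τ : ℂ →+* ℂ).comp x.2⟩, by
      rintro ⟨i, φ⟩ ⟨j, ψ⟩ h
      obtain ⟨h1, h2⟩ := Sigma.mk.inj_iff.1 h
      subst h1
      have h3 := eq_of_heq h2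
      refine Sigma.ext rfl (heq_of_eq (RingHom.ext fun z => τ.injective ?_))
      have h4 := RingHom.congr_fun h3 z
      simpa only [RingHom.coe_comp, RingHom.coe_coe, Function.comp_apply] using h4⟩
  let ev : ((i : Fin n) × (K i →+* ℂ)) → ℂ := fun x => x.2 ((a x.1 : 𝓞 (K x.1)) : K x.1)
  have hf : ∀ x, complexBetti.map (biproduct.map fun i => ι i (a i)).hom.hom.hom 1 (w x) =
      (RingHom.id ℂ) (ev x) • w x := fun x => hwθ a x
  have hsep : Function.Injective fun s : Set.powersetCard ((i : Fin n) × (K i →+* ℂ)) (2 * p) =>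
      ∏ i ∈ (s : Finset ((i : Fin n) × (K i →+* ℂ))), ev i :=
    fun s t hst => Subtype.ext (ha hst)
  have hperm : ∀ (τ : ℂ ≃+* ℂ) (x : (i : Fin n) × (K i →+* ℂ)),
      (τ : ℂ →+* ℂ) (ev x) = ev (perm τ x) := fun τ x => rfl
  have hfix : ∀ x : ℂ, (∀ τ : ℂ ≃+* ℂ, (τ : ℂ →+* ℂ) x = x) → x ∈ Set.range (algebraMap ℚ ℂ) :=
    fun x hx => mem_range_algebraMap_rat_of_forall_ringEquiv hx
  -- (4) the balanced `2p`-weights, their types and their Galois stability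
  let B : Finset (Set.powersetCard ((i : Fin n) × (K i →+* ℂ)) (2 * p)) :=
    Finset.univ.filter fun s => IsGaloisBalancedAlg Φ (s : Finset ((i : Fin n) × (K i →+* ℂ)))
  have hBt : ∀ s ∈ B, IsOfHodgeType (⨁ A).dim (⨁ A).X (2 * p) p p (b s) := by
    intro s hs
    have hsb : IsGaloisBalancedAlg Φ (s : Finset ((i : Fin n) × (K i →+* ℂ))) :=
      (Finset.mem_filter.1 hs).2
    have h := isOfHodgeType_monomial hX hb (fun x : (i : Fin n) × (K i →+* ℂ) => x.2 ∈ (Φ x.1).1)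
      hv10 hv01 s
    have h1 := hsb.card_eq_two_mul
    rw [Set.powersetCard.card_eq] at h1
    have hrefl : ∀ x : (i : Fin n) × (K i →+* ℂ),
        ((RingEquiv.refl ℂ : ℂ ≃+* ℂ) : ℂ →+* ℂ).comp x.2 = x.2 := fun x => RingHom.ext fun _ => rfl
    have h0 := hsb (RingEquiv.refl ℂ)
    simp only [hrefl] at h0
    have hc : {x | x ∈ (s : Finset ((i : Fin n) × (K i →+* ℂ))) ∧ x.2 ∈ (Φ x.1).1}.ncard = p := by
      omega
    have hc' : {x | x ∈ (s : Finset ((i : Fin n) × (K i →+* ℂ))) ∧ x.2 ∉ (Φ x.1).1}.ncard = p := by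
      rw [← h0, hc]
    simp only [hc, hc'] at h
    exact h
  have hBs : ∀ τ, ∀ s ∈ B, Set.powersetCard.map (2 * p) (perm τ) s ∈ B := by
    intro τ s hs
    have hsb : IsGaloisBalancedAlg Φ (s : Finset ((i : Fin n) × (K i →+* ℂ))) :=
      (Finset.mem_filter.1 hs).2
    refine Finset.mem_filter.2 ⟨Finset.mem_univ _, fun τ'' => ?_⟩
    have hcomp : ∀ x : (i : Fin n) × (K i →+* ℂ), (τ'' : ℂ →+* ℂ).comp (perm τ x).2 =
        ((τ.trans τ'') : ℂ →+* ℂ).comp x.2 := fun x => by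
      rw [show (perm τ x).2 = (τ : ℂ →+* ℂ).comp x.2 from rfl, RingEquiv.coe_ringHom_trans,
        RingHom.comp_assoc]
    show {x | x ∈ (s : Finset ((i : Fin n) × (K i →+* ℂ))).map (perm τ) ∧
        (τ'' : ℂ →+* ℂ).comp x.2 ∈ (Φ x.1).1}.ncard =
      {x | x ∈ (s : Finset ((i : Fin n) × (K i →+* ℂ))).map (perm τ) ∧
        (τ'' : ℂ →+* ℂ).comp x.2 ∉ (Φ x.1).1}.ncard
    rw [ncard_sep_map_eq'', ncard_sep_map_eq'']
    simp only [hcomp]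
    exact hsb (τ.trans τ'')
  -- (5) `B^p ⊗ ℂ` is the span of the balanced monomials
  have hsub : hodgeClassSpan (⨁ A).dim (⨁ A).X p ≤ Submodule.span ℂ (b '' ↑B) := by
    refine Submodule.span_le.2 ?_
    rintro c ⟨hcQ, hcH⟩
    have h := mem_span_monomials_of_isRationalClass hX hb
      (fun x : (i : Fin n) × (K i →+* ℂ) => x.2 ∈ (Φ x.1).1) hv10 hv01
      (RingHom.id ℂ) ev (biproduct.map fun i => ι i (a i)).hom.hom.hom hf hsep
      (fun τ : ℂ ≃+* ℂ => (τ : ℂ →+* ℂ)) perm hperm (by omega : p + p = 2 * p) hcQ hcH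
    refine Submodule.span_mono (Set.image_mono fun s hs => ?_) h
    rw [Finset.mem_coe, Finset.mem_filter]
    refine ⟨Finset.mem_univ _, fun τ => ?_⟩
    have h1 : {x | x ∈ (s : Finset ((i : Fin n) × (K i →+* ℂ))) ∧
        (perm τ x).2 ∈ (Φ (perm τ x).1).1}.ncard = p := (hs τ).1
    have h2 : {x | x ∈ (s : Finset ((i : Fin n) × (K i →+* ℂ))) ∧
        (perm τ x).2 ∉ (Φ (perm τ x).1).1}.ncard = p := (hs τ).2
    show {x | x ∈ (s : Finset ((i : Fin n) × (K i →+* ℂ))) ∧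
        (perm τ x).2 ∈ (Φ (perm τ x).1).1}.ncard =
      {x | x ∈ (s : Finset ((i : Fin n) × (K i →+* ℂ))) ∧
        (perm τ x).2 ∉ (Φ (perm τ x).1).1}.ncard
    rw [h1, h2]
  have hsup : Submodule.span ℂ (b '' ↑B) ≤ hodgeClassSpan (⨁ A).dim (⨁ A).X p := by
    refine Submodule.span_le.2 ?_
    rintro _ ⟨s, hs, rfl⟩
    exact monomial_mem_span_of_stable hX hb (RingHom.id ℂ) ev
      (biproduct.map fun i => ι i (a i)).hom.hom.hom hf hsep
      (fun τ : ℂ ≃+* ℂ => (τ : ℂ →+* ℂ)) perm hperm hfix (by omega : p + p = 2 * p) B hBt hBs hs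
  have heq : hodgeClassSpan (⨁ A).dim (⨁ A).X p = Submodule.span ℂ (b '' ↑B) :=
    le_antisymm hsub hsup
  -- (6) `ℂ w_S = H^{2p}(⨁ A)_S`
  have hmono : ∀ s : Set.powersetCard ((i : Fin n) × (K i →+* ℂ)) (2 * p),
      b s ∈ weightClassesAlg A ι (2 * p) (s : Finset ((i : Fin n) × (K i →+* ℂ))) := fun s =>
    mem_weightClassesAlg_iff.2 fun c => map_monomial_eq_prod_smul hb _ (hwθ c) s
  have hline : ∀ s : Set.powersetCard ((i : Fin n) × (K i →+* ℂ)) (2 * p),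
      weightClassesAlg A ι (2 * p) (s : Finset ((i : Fin n) × (K i →+* ℂ))) ≤ ℂ ∙ b s := by
    intro s x hx
    have hxu := (mem_weightClassesAlg_iff.1 hx) a
    exact mem_span_singleton_of_apply_eq_smul'' b
      (complexBetti.map (biproduct.map fun i => ι i (a i)).hom.hom.hom (2 * p)).hom
      (fun t : Set.powersetCard ((i : Fin n) × (K i →+* ℂ)) (2 * p) =>
        ∏ x ∈ (t : Finset ((i : Fin n) × (K i →+* ℂ))), x.2 ((a x.1 : 𝓞 (K x.1)) : K x.1))
      (fun t => map_monomial_eq_prod_smul hb _ (hwθ a) t)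
      (fun t t' h => Subtype.ext (ha h)) hxu
  have heq2 : Submodule.span ℂ (b '' ↑B) =
      ⨆ S ∈ pohlmannSetsAlg Φ p, weightClassesAlg A ι (2 * p) S := by
    apply le_antisymm
    · refine Submodule.span_le.2 ?_
      rintro _ ⟨s, hs, rfl⟩
      have hsP : (s : Finset ((i : Fin n) × (K i →+* ℂ))) ∈ pohlmannSetsAlg Φ p :=
        ⟨Set.powersetCard.card_eq s, (Finset.mem_filter.1 hs).2⟩
      exact Submodule.mem_iSup_of_mem (s : Finset ((i : Fin n) × (K i →+* ℂ)))
        (Submodule.mem_iSup_of_mem hsP (hmono s))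
    · refine iSup₂_le fun S hS => ?_
      obtain ⟨hcard, hbalS⟩ := hS
      let s : Set.powersetCard ((i : Fin n) × (K i →+* ℂ)) (2 * p) := Set.powersetCard.ofCard hcard
      have hsB : s ∈ B := Finset.mem_filter.2 ⟨Finset.mem_univ _, hbalS⟩
      calc weightClassesAlg A ι (2 * p) S
          = weightClassesAlg A ι (2 * p) (s : Finset ((i : Fin n) × (K i →+* ℂ))) := rfl
        _ ≤ ℂ ∙ b s := hline s
        _ ≤ Submodule.span ℂ (b '' ↑B) :=
          Submodule.span_mono (Set.singleton_subset_iff.2 ⟨s, hsB, rfl⟩)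
  refine ⟨heq.trans heq2, ?_⟩
  -- (7) the count
  rw [heq, finrank_span_image_basis'']
  have hset : pohlmannSetsAlg Φ p =
      Subtype.val '' (↑B : Set (Set.powersetCard ((i : Fin n) × (K i →+* ℂ)) (2 * p))) := by
    ext S
    constructor
    · rintro ⟨hcard, hbalS⟩
      exact ⟨Set.powersetCard.ofCard hcard, Finset.mem_filter.2 ⟨Finset.mem_univ _, hbalS⟩, rfl⟩
    · rintro ⟨s, hs, rfl⟩
      exact ⟨Set.powersetCard.card_eq s, (Finset.mem_filter.1 hs).2⟩
  rw [hset, Set.ncard_image_of_injective _ Subtype.val_injective, Set.ncard_coe_finset]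

/-! ### Consequences recorded for consumers -/

variable {n : ℕ} {K : Fin n → Type} [∀ i, Field (K i)] [∀ i, NumberField (K i)]
  {A : Fin n → AbelianVariety ℂ} {Φ : ∀ i, CMType (K i)} {ι : ∀ i, 𝓞 (K i) →+* End (A i)}
  {θ : ∀ i, K i →+* Module.End ℂ (complexBetti (A i).X 1)}

/-- The weight classes of a balanced weight of size `2p` are in `B^p(B) ⊗ ℂ` (the `⊇` half: "`[P] ∈ B^p(A) ⊗ ℂ`").
[cite: GaoUllmo2025, Thm. 3.1] -/
theorem weightClassesAlg_le_hodgeClassSpan (hA : ∀ i, IsCMTypeRealisation (Φ i) (A i) (ι i) (θ i))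
    {p : ℕ} {S : Finset ((i : Fin n) × (K i →+* ℂ))} (hS : S ∈ pohlmannSetsAlg Φ p) :
    weightClassesAlg A ι (2 * p) S ≤ hodgeClassSpan (⨁ A).dim (⨁ A).X p := by
  rw [(Pohlmann1968_thm1_cmAlgebra K A Φ ι θ hA p).1]
  exact le_iSup₂_of_le S hS le_rfl

/-- Every rational `(p,p)`-class of the product lies in the span of the weight classes of the balanced weights
(the `⊆` half: "each element of `B^p(A)` is a combination of `[Δ]` satisfying the condition").
[cite: GaoUllmo2025, Thm. 3.1] [cite: Gordon1999HodgeAVSurvey, §9.2] -/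
theorem mem_iSup_weightClassesAlg (hA : ∀ i, IsCMTypeRealisation (Φ i) (A i) (ι i) (θ i)) {p : ℕ}
    {c : complexBetti (⨁ A).X (2 * p)} (hcQ : IsRationalClass c)
    (hcH : IsOfHodgeType (⨁ A).dim (⨁ A).X (2 * p) p p c) :
    c ∈ ⨆ S ∈ pohlmannSetsAlg Φ p, weightClassesAlg A ι (2 * p) S := by
  rw [← (Pohlmann1968_thm1_cmAlgebra K A Φ ι θ hA p).1]
  exact Submodule.subset_span ⟨hcQ, hcH⟩

/-- **"In particular `dim_ℚ B^p(A)` is the number of ordered `P ∈ 𝒫(S)` with `|P| = 2p` satisfying (3.2)"**: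
`dim_ℂ (B^p(B) ⊗ ℂ) = #pohlmannSetsAlg Φ p`. [cite: GaoUllmo2025, Thm. 3.1] [cite: Pohlmann1968, Thm. 1] -/
theorem finrank_hodgeClassSpan_eq_ncard_pohlmannSetsAlg
    (hA : ∀ i, IsCMTypeRealisation (Φ i) (A i) (ι i) (θ i)) (p : ℕ) :
    Module.finrank ℂ ↥(hodgeClassSpan (⨁ A).dim (⨁ A).X p) = (pohlmannSetsAlg Φ p).ncard :=
  (Pohlmann1968_thm1_cmAlgebra K A Φ ι θ hA p).2

end TheoremA

end Literature.AlgebraicGeometry.Pohlmann1968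

end
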